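import Literature.AlgebraicGeometry.Resolution.ProperModels
import Literature.AlgebraicGeometry.Resolution.ZariskiFiniteness
import Literature.AlgebraicGeometry.Resolution.SmoothUniformization
import Literature.AlgebraicGeometry.Resolution.InseparableLocalUniformizationDescent
import HarnessLib

/-!
# Crux `Pialt` (stmt-ResolutionOfSingularities-0555), PiTMP programme: transfer of valuations and centres along a
# finite purely inseparable extension of the function field

Line lead c5 (prover-line-stmt-ResolutionOfSingularities-0555-c5-0, 2026-08-17). Glue for the engine
`Temkin2013 ∧ PiTMP ⟹ Pialt` (purely inseparable two-model patching): valuation rings extend UNIQUELY along a purely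
inseparable extension `L/K` (`exists_valuationSubring_comap_eq`, Chevalley, and
`valuationSubring_eq_of_comap_eq_of_isPurelyInseparable`, both in tree), so the Zariski–Riemann spaces `Zar(L/k)` and
`Zar(K/k)` are identified; this file proves what the engine needs about that identification.

* `mem_iff_of_comap_eq` — membership in the extension is read on `K`: if `y ↦ x ^ n` then `x ∈ O' ↔ y ∈ O`.
* `algebraMap_mem_of_comap_eq` — the extension contains `k`.
* `ZariskiRiemannSpace.continuous_of_comap_eq` — ANY map `Zar(K/k) → Zar(L/k)` compatible with restriction is
  continuous (`L/K` purely inseparable: the preimage of `E(x)` is `E(y)` with `y ↦ x^{p^e}`).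
* `ZariskiRiemannSpace.eq_of_comap_eq` — and is inverse to restriction (uniqueness).
* `ProperModel.map_centre_of_comap_eq` — **centres map to centres across the field extension**: for proper models
  `N` of `L` and `M` of `K` and a `k`-morphism `φ : N → M` compatible with the generic points along `K → L`, the
  centre of `w'` on `N` maps to the centre of `w = w' ∩ K` on `M` (valuative criterion: both `Spec O_{w'} → N → M`
  and `Spec O_{w'} → Spec O_w → M` lift the same square, and `M` is separated).
* `ProperModel.regCentre_of_comap_eq` — hence a `RegLe`-type morphism transports regular centres upstairs.

Everything is [folklore] (Zariski–Samuel II, Ch. VI §17; EGA II 7.3.8).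
-/

set_option linter.dupNamespace false

noncomputable section

open CategoryTheory AlgebraicGeometry IsLocalRing
open Literature.AlgebraicGeometry.Resolution

namespace Summit.ResolutionOfSingularities.ResolutionOfSingularities.Theorems.Pialt.PiPatching

/-! ## Valuation rings along a purely inseparable extension -/

section valuation

/-- Membership in a valuation ring of `L` lying over `O` is read on `K` through a power: if
`algebraMap K L y = x ^ n` with `0 < n`, then `x ∈ O' ↔ y ∈ O`. [folklore] -/
theorem mem_iff_of_comap_eq {K L : Type} [Field K] [Field L] [Algebra K L]
    (O : ValuationSubring K) {O' : ValuationSubring L}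
    (h : O'.comap (algebraMap K L) = O) {x : L} {y : K} {n : ℕ} (hn : 0 < n)
    (hxy : algebraMap K L y = x ^ n) : x ∈ O' ↔ y ∈ O := by
  constructor
  · intro hx
    have : y ∈ O'.comap (algebraMap K L) := by
      rw [ValuationSubring.mem_comap, hxy]; exact pow_mem hx n
    rwa [h] at this
  · intro hy
    have hy' : y ∈ O'.comap (algebraMap K L) := by rw [h]; exact hy
    rw [ValuationSubring.mem_comap, hxy] at hy'
    exact mem_valuationSubring_of_pow_mem O' hn hy'

/-- A valuation ring of `L` lying over a valuation ring `O ⊇ k` of `K` contains `k`. [folklore] -/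
theorem algebraMap_mem_of_comap_eq {k K L : Type} [Field k] [Field K] [Field L] [Algebra k K]
    [Algebra k L] [Algebra K L] [IsScalarTower k K L] (O : ValuationSubring K) {O' : ValuationSubring L} (h : O'.comap (algebraMap K L) = O)
    (hk : ∀ c : k, algebraMap k K c ∈ O) (c : k) : algebraMap k L c ∈ O' := by
  have : algebraMap k K c ∈ O'.comap (algebraMap K L) := by rw [h]; exact hk c
  rwa [ValuationSubring.mem_comap, ← IsScalarTower.algebraMap_apply] at this

end valuation

/-! ## The identification `Zar(K/k) ≅ Zar(L/k)` -/

section zar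

/-- **Continuity of the extension map.** For `L/K` purely inseparable, any map
`ext : Zar(K/k) → Zar(L/k)` with `ext(w) ∩ K = w` is continuous: the preimage of the subbasic open `E(x)`,
`x ∈ L`, is `E(y)` where `y ∈ K` with `y = x^{p^e}` in `L`. [cite: ZariskiSamuel1960, Ch. VI §17] -/
theorem _root_.Literature.AlgebraicGeometry.Resolution.ZariskiRiemannSpace.continuous_of_comap_eq
    {k K L : Type} [Field k] [Field K] [Field L] [Algebra k K] [Algebra k L] [Algebra K L]
    [IsPurelyInseparable K L] (ext : ZariskiRiemannSpace k K → ZariskiRiemannSpace k L)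
    (hext : ∀ w, (ext w).asValuationSubring.comap (algebraMap K L) = w.asValuationSubring) :
    Continuous ext := by
  refine continuous_generateFrom_iff.mpr ?_
  rintro _ ⟨x, rfl⟩
  obtain ⟨n, y, hy⟩ := IsPurelyInseparable.pow_mem K (ringExpChar K) x
  have hpos : 0 < ringExpChar K ^ n := expChar_pow_pos K (ringExpChar K) n
  have : ext ⁻¹' ZariskiRiemannSpace.basicOpen x = ZariskiRiemannSpace.basicOpen (A := k) y := by
    ext w
    simp only [Set.mem_preimage, ZariskiRiemannSpace.mem_basicOpen]
    exact mem_iff_of_comap_eq w.asValuationSubring (hext w) hpos hy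
  rw [this]
  exact ZariskiRiemannSpace.isOpen_basicOpen y

/-- **Uniqueness**: a point of `Zar(L/k)` lying over `w` IS `ext w` (`L/K` purely inseparable). [folklore] -/
theorem _root_.Literature.AlgebraicGeometry.Resolution.ZariskiRiemannSpace.eq_of_comap_eq
    {k K L : Type} [Field k] [Field K] [Field L] [Algebra k K] [Algebra k L] [Algebra K L]
    [IsPurelyInseparable K L] (ext : ZariskiRiemannSpace k K → ZariskiRiemannSpace k L)
    (hext : ∀ w, (ext w).asValuationSubring.comap (algebraMap K L) = w.asValuationSubring)
    (w : ZariskiRiemannSpace k K) (w' : ZariskiRiemannSpace k L)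
    (h : w'.asValuationSubring.comap (algebraMap K L) = w.asValuationSubring) : ext w = w' :=
  ZariskiRiemannSpace.ext
    (valuationSubring_eq_of_comap_eq_of_isPurelyInseparable (K := K) ((hext w).trans h.symm))

/-- **Existence** of a point of `Zar(L/k)` over every point of `Zar(K/k)` (Chevalley), for any field extension
`L/K`. [folklore] -/
theorem _root_.Literature.AlgebraicGeometry.Resolution.ZariskiRiemannSpace.exists_comap_eq
    {k K L : Type} [Field k] [Field K] [Field L] [Algebra k K] [Algebra k L] [Algebra K L]
    [IsScalarTower k K L] (w : ZariskiRiemannSpace k K) :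
    ∃ w' : ZariskiRiemannSpace k L, w'.asValuationSubring.comap (algebraMap K L) = w.asValuationSubring := by
  obtain ⟨P, hP⟩ := exists_valuationSubring_comap_eq (Ω := L) w.asValuationSubring
  exact ⟨⟨P, algebraMap_mem_of_comap_eq w.asValuationSubring hP w.algebraMap_mem⟩, hP⟩

/-- Restriction to `K` of a point of `Zar(L/k)`, as a point of `Zar(K/k)`. [folklore] -/
theorem _root_.Literature.AlgebraicGeometry.Resolution.ZariskiRiemannSpace.algebraMap_mem_comap
    {k K L : Type} [Field k] [Field K] [Field L] [Algebra k K] [Algebra k L] [Algebra K L]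
    [IsScalarTower k K L] (w' : ZariskiRiemannSpace k L) (c : k) :
    algebraMap k K c ∈ w'.asValuationSubring.comap (algebraMap K L) := by
  rw [ValuationSubring.mem_comap, ← IsScalarTower.algebraMap_apply]
  exact w'.algebraMap_mem c

end zar

/-! ## Centres map to centres across the field extension -/

section centre

/-- The inclusion `O_w → O_{w'}` of a valuation ring of `K` into a valuation ring of `L` lying over it.
[folklore] -/
theorem mapsTo_of_comap_eq {k K L : Type} [Field k] [Field K] [Field L] [Algebra k K] [Algebra k L]
    [Algebra K L] (w : ZariskiRiemannSpace k K) (w' : ZariskiRiemannSpace k L)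
    (h : w'.asValuationSubring.comap (algebraMap K L) = w.asValuationSubring) (y : w.asValuationSubring) :
    algebraMap K L (y : K) ∈ w'.asValuationSubring := by
  have : (y : K) ∈ w'.asValuationSubring.comap (algebraMap K L) := by rw [h]; exact y.2
  exact this

/-- **Centres map to centres across a purely inseparable (indeed any) extension of the function field.** Let
`M` be a proper model of `K/k`, `N` a proper model of `L/k`, `φ : N → M` a `k`-morphism compatible with the
generic points along `K → L`, and `w' ∈ Zar(L/k)` a valuation ring lying over `w ∈ Zar(K/k)`. Then `φ` maps the
centre of `w'` on `N` to the centre of `w` on `M`: both `Spec O_{w'} → N → M` and `Spec O_{w'} → Spec O_w → M` lift the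
valuative square of `M → Spec k` with top `Spec L → M`, so they agree (`M` separated), and `O_w → O_{w'}` is local.
[cite: ZariskiSamuel1960, Ch. VI §17] -/
theorem _root_.Literature.AlgebraicGeometry.Resolution.ProperModel.map_centre_of_comap_eq
    {k K L : Type} [Field k] [Field K] [Field L] [Algebra k K] [Algebra k L] [Algebra K L]
    [IsScalarTower k K L] (M : ProperModel k K) (N : ProperModel k L) (φ : N.X ⟶ M.X) (hπ : φ ≫ M.π = N.π)
    (hgen : N.gen ≫ φ = Spec.map (CommRingCat.ofHom (algebraMap K L)) ≫ M.gen)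
    (w : ZariskiRiemannSpace k K) (w' : ZariskiRiemannSpace k L)
    (h : w'.asValuationSubring.comap (algebraMap K L) = w.asValuationSubring) :
    φ.base (N.centre w') = M.centre w := by
  classical
  -- the local inclusion `ρ : O_w → O_{w'}`
  let Ow := w.asValuationSubring
  let Ow' := w'.asValuationSubring
  let ρ : Ow →+* Ow' :=
    { toFun := fun y => ⟨algebraMap K L (y : K), mapsTo_of_comap_eq w w' h y⟩
      map_one' := Subtype.ext (by simp)
      map_mul' := fun a b => Subtype.ext (by simp)
      map_zero' := Subtype.ext (by simp)
      map_add' := fun a b => Subtype.ext (by simp) }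
  have hρ : ∀ y : Ow, ((ρ y : Ow') : L) = algebraMap K L (y : K) := fun _ => rfl
  haveI : IsLocalHom ρ := by
    refine ⟨fun y hy => ?_⟩
    -- `ρ y` a unit of `O_{w'}` ⇒ `y⁻¹ ∈ O_w`
    have h1 : Ow'.valuation (algebraMap K L (y : K)) = 1 := by
      have := (Ow'.valuation_eq_one_iff (ρ y)).mp hy
      rwa [hρ] at this
    have hy0 : algebraMap K L (y : K) ≠ 0 := by
      intro h0; rw [h0, map_zero] at h1; exact zero_ne_one h1
    have hinv' : (algebraMap K L (y : K))⁻¹ ∈ Ow' :=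
      (Ow'.valuation_le_one_iff _).mp (by rw [map_inv₀, h1, inv_one])
    have hinv : (y : K)⁻¹ ∈ Ow := by
      have : (y : K)⁻¹ ∈ Ow'.comap (algebraMap K L) := by
        rw [ValuationSubring.mem_comap, map_inv₀]; exact hinv'
      rwa [h] at this
    have hy0' : (y : K) ≠ 0 := fun h0 => hy0 (by rw [h0, map_zero])
    exact isUnit_iff_exists_inv.mpr ⟨⟨(y : K)⁻¹, hinv⟩, Subtype.ext (mul_inv_cancel₀ hy0')⟩
  -- the two lifts of the valuative square with top `Spec L → M.X` over `Spec O_{w'} → Spec k`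
  obtain ⟨l', hl'₁, hl'₂, hl'₃⟩ := N.isCentre_centre w'
  obtain ⟨l₀, hl₀₁, hl₀₂, hl₀₃⟩ := M.isCentre_centre w
  -- compatibilities of `ρ` with the structure maps
  have hρK : (CommRingCat.ofHom ρ) ≫ CommRingCat.ofHom (algebraMap Ow' L) =
      CommRingCat.ofHom (algebraMap Ow K) ≫ CommRingCat.ofHom (algebraMap K L) := by
    ext y; rfl
  have hρk : CommRingCat.ofHom (KModel.toValuationSubringHom w) ≫ CommRingCat.ofHom ρ =
      CommRingCat.ofHom (KModel.toValuationSubringHom w') := by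
    ext c
    change algebraMap K L (algebraMap k K c) = algebraMap k L c
    exact (IsScalarTower.algebraMap_apply k K L c).symm
  have hspecK : KModel.specKTo w' ≫ Spec.map (CommRingCat.ofHom ρ) =
      Spec.map (CommRingCat.ofHom (algebraMap K L)) ≫ KModel.specKTo w := by
    change Spec.map _ ≫ Spec.map _ = Spec.map _ ≫ Spec.map _
    rw [← Spec.map_comp, ← Spec.map_comp, hρK]
  have hspecO : Spec.map (CommRingCat.ofHom ρ) ≫ KModel.specOTo w = KModel.specOTo w' := by
    change Spec.map _ ≫ Spec.map _ = Spec.map _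
    rw [← Spec.map_comp, hρk]
  -- the square
  let sq : ValuativeCommSq M.π :=
    { R := Ow'
      K := L
      i₁ := Spec.map (CommRingCat.ofHom (algebraMap K L)) ≫ M.gen
      i₂ := KModel.specOTo w'
      commSq := ⟨by
        rw [Category.assoc, M.gen_π, ← Spec.map_comp]
        change Spec.map _ = KModel.specKTo w' ≫ KModel.specOTo w'
        rw [KModel.specKTo_specOTo, ← CommRingCat.ofHom_comp, ← IsScalarTower.algebraMap_eq]⟩ }
  have hsub : Subsingleton sq.commSq.LiftStruct := IsSeparated.valuativeCriterion M.π sq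
  have hAB : l' ≫ φ = Spec.map (CommRingCat.ofHom ρ) ≫ l₀ :=
    congrArg CommSq.LiftStruct.l (hsub.elim
      ⟨l' ≫ φ, by
        change KModel.specKTo w' ≫ (l' ≫ φ) = _
        rw [← Category.assoc, hl'₁, hgen], by rw [Category.assoc, hπ, hl'₂]⟩
      ⟨Spec.map (CommRingCat.ofHom ρ) ≫ l₀, by
        change KModel.specKTo w' ≫ (Spec.map (CommRingCat.ofHom ρ) ≫ l₀) = _
        rw [← Category.assoc, hspecK, Category.assoc, hl₀₁], by
        rw [Category.assoc, hl₀₂, hspecO]⟩)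
  -- evaluate at the closed point of `Spec O_{w'}`
  have hcl : (Spec.map (CommRingCat.ofHom ρ)).base (closedPoint Ow') = closedPoint Ow := by
    change PrimeSpectrum.comap ρ (closedPoint Ow') = closedPoint Ow
    exact IsLocalRing.comap_closedPoint ρ
  calc φ.base (N.centre w') = (l' ≫ φ).base (closedPoint Ow') := by
        rw [← hl'₃]; rfl
    _ = (Spec.map (CommRingCat.ofHom ρ) ≫ l₀).base (closedPoint Ow') := by rw [hAB]
    _ = l₀.base (closedPoint Ow) := by
        rw [Scheme.Hom.comp_base, TopCat.coe_comp, Function.comp_apply, hcl]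
    _ = M.centre w := hl₀₃

/-- **Regular centres ascend along a `RegLe`-type morphism across the field extension**: with `M, N, φ` as in
`ProperModel.map_centre_of_comap_eq`, if `φ` is regular over the regular locus of `M` and `w` has a regular centre
on `M`, then every `w'` over `w` has a regular centre on `N`. [folklore] -/
theorem _root_.Literature.AlgebraicGeometry.Resolution.ProperModel.regCentre_of_comap_eq
    {k K L : Type} [Field k] [Field K] [Field L] [Algebra k K] [Algebra k L] [Algebra K L]
    [IsScalarTower k K L] (M : ProperModel k K) (N : ProperModel k L) (φ : N.X ⟶ M.X) (hπ : φ ≫ M.π = N.π)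
    (hgen : N.gen ≫ φ = Spec.map (CommRingCat.ofHom (algebraMap K L)) ≫ M.gen)
    (hregle : ∀ n : N.X, IsRegularLocalRing (M.X.presheaf.stalk (φ.base n)) →
      IsRegularLocalRing (N.X.presheaf.stalk n))
    {w : ZariskiRiemannSpace k K} {w' : ZariskiRiemannSpace k L}
    (h : w'.asValuationSubring.comap (algebraMap K L) = w.asValuationSubring) (hM : M.RegCentre w) :
    N.RegCentre w' := by
  unfold ProperModel.RegCentre at hM ⊢
  apply hregle
  rw [ProperModel.map_centre_of_comap_eq M N φ hπ hgen w w' h]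
  exact hM

end centre

end Summit.ResolutionOfSingularities.ResolutionOfSingularities.Theorems.Pialt.PiPatching

end
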